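import Mathlib
import Literature.Computability.Complexity.RangeAvoidance
import Summits.PneNP.PneNP.Theorems.PstarSAHeadline
import Summits.PneNP.PneNP.Theorems.PstarTypedSALinearLevelPrime
import Summits.PneNP.PneNP.Theorems.PstarExpandingExist

/-!
# The ROUND-21 headline: Sherali–Adams of linear level is blind on pure `P⋆` at every linear stretch

FRONTIER range-avoidance ladder, rung F-N3 context (cell `pnp-ideate`, ROUND-21; a restricted-model lower bound for a
relaxation hierarchy — nothing here bears on `P` vs `NP`).

`PstarSAHeadline.SALinearBlind`: at every linear stretch `C` there is `c > 0` such that for infinitely many `n` some pure-`P⋆`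
instance with `m ≥ C·n` outputs has a point outside its range and yet level-`n/c` Sherali–Adams is feasible for EVERY target.
It follows BY NAME (`PstarSAHeadline.saLinearBlind_of'`) from the two theorems of this round:

* `PstarTypedSALinearLevel.typedSALinearLevel'` (T21.1, planner p3 / prover-2: the Benabbas–Georgiou–Magen–Tulsiani transfer
  with balance replaced by type-consistent biases; closure and assembly `PstarSAClosure`, `PstarSAAssembly`), and
* `PstarExpandingExist.expandingTypedExist'` (T21.1′: boundary-expanding typed pure-`P⋆` instances exist at every linear
  stretch, by a first-moment count).
-/

set_option linter.dupNamespace false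

namespace Summit.PneNP.PneNP.Theorems.PstarSALinearBlind

/-- **SA at linear level is blind on pure `P⋆`** (`PstarSAHeadline.SALinearBlind`): at every linear stretch there are pure
`P⋆` instances with non-range points on which Sherali–Adams of level `n/c` is feasible for every target.  Restricted-model
lower bound of the range-avoidance ladder (cell pnp-ideate, ROUND-21); it says nothing about `P` versus `NP`. -/
theorem saLinearBlind : PstarSAHeadline.SALinearBlind :=
  PstarSAHeadline.saLinearBlind_of' PstarTypedSALinearLevel.typedSALinearLevel' PstarExpandingExist.expandingTypedExist'

end Summit.PneNP.PneNP.Theorems.PstarSALinearBlind
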